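import Literature.NumberTheory.LFunctions.KMVPrimeAveragedDiagOnly
import Summits.Parity.GeneralizedHardyLittlewood.Theses.PrimeLevelFamEdge
import HarnessLib

/-!
# `C⁺ ⇒ K_B`: the first lemma of the §D card `good-primes-table-squeeze`, Summits side

Supports stmt-Parity-20343 (`BeyondDiagonalBeatsQuarter`, route `PrimeLevelFamEdge` rev 3; supersedes
stmt-Parity-20055): if the mollified first and second harmonic moments are diagonal-only ON AVERAGE over
the good primes of dyadic blocks on some window `(1, b)` (`KMV2000.PrimeAveragedDiagOnly 1 b`, the
card's `C⁺` — NOT in print, (A)-sensitive per the card, graded VARIANT by ls-knife-crit-1 g6), then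
the VALUE crux holds (rev 3: its printed first-moment antecedent `bettin2017_theorem11_primeLevel` is
discarded). A REDUCTION; it eliminates nothing. All content is the Literature theorem
`KMV2000.beatsQuarter_ab_of_primeAveragedDiagOnly` (p523798; cell landau-siegel, ls-knife-typer-3).
«The programme SEARCHES and TYPES; no claim about Landau–Siegel zeros, Theorems 1–2 of
arXiv:2211.02515 or a repaired Margin232 until a kernel theorem says so.»
-/

namespace Summit.Parity.GeneralizedHardyLittlewood.Theorems

open Literature.NumberTheory.LFunctions

/-- **First lemma of the card `good-primes-table-squeeze`**: an averaged diagonal-only statement on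
some window `(1, b)` gives the route's VALUE crux `BeyondDiagonalBeatsQuarter` (K_B; rev 3 = the printed
first-moment fact `bettin2017_theorem11_primeLevel` → the rev-1 sub-window body — the antecedent is
simply discarded), by the
squeeze `KMV2000.beatsQuarter_ab_of_primeAveragedDiagOnly` (uniqueness of the extra main terms along
good primes + the envelope at `P = X²`). -/
theorem firstLemma_squeeze (h : ∃ b : ℝ, 1 < b ∧ KMV2000.PrimeAveragedDiagOnly 1 b) :
    Summit.Parity.GeneralizedHardyLittlewood.Theses.PrimeLevelFamEdge.BeyondDiagonalBeatsQuarter := by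
  unfold Summit.Parity.GeneralizedHardyLittlewood.Theses.PrimeLevelFamEdge.BeyondDiagonalBeatsQuarter
  obtain ⟨b, hb, hav⟩ := h
  exact fun _ => KMV2000.beatsQuarter_ab_of_primeAveragedDiagOnly le_rfl hb hav

end Summit.Parity.GeneralizedHardyLittlewood.Theorems
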